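import Mathlib

/-!
# Route BarrierLever — item `PartitionMinorsHitByVP` (stmt-ValiantsHypothesis-19717):
# Conjecture Q\* — the SYMBOLIC additive matrix and the SPLIT RULE (exact hyperplane sections)

Helper file (`--supports stmt-ValiantsHypothesis-19717`; cell valiant-natproofs, rung V4, 𝒟-side of door (c); prover seat
val-np-p3 gen 7). Definition-free except for two `abbrev`-free plain `def`s of polynomial matrices (no `Prop` assertions). Closes NO item.

`HiddenStates.BallGood h K r u` (file `…HiddenStatesBall`) asks for a numeric table making the additive matrix
`[∏_{a ∈ u i} (t none a + Σ_{q ∈ e k} t (some q) a)]_{i,k}` nonsingular. Here the table is SYMBOLIC: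

* `symbLin K h a J = X (none, a) + Σ_{q ∈ J} X (some q, a)` — the generic affine functional of coordinate `a` at the hidden set `J`;
  `symbAdd u e = [∏_{a ∈ u i} symbLin a (e k)]_{i,k}` over `MvPolynomial (Option (Fin K) × Fin h) ℂ`; `SymbGood u e := det ≠ 0`.
* `exists_table_of_symbGood` — a nonzero polynomial over `ℂ` has a non-root, so symbolic goodness gives the numeric table
  asked for by `HiddenStates.BallGood` (file `…HiddenStatesBall`; the one-line corollary lives with its users, keeping this
  engine free of any route import).
* **`symbGood_of_split` — THE SPLIT RULE.** Fix a coordinate `a` and an affine functional `φ(J) = c₀ + Σ_{q∈J} c q` on hidden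
  sets. If the rows containing `a` are in bijection (`κ₁`) with the columns where `φ ≠ 0`, the rows avoiding `a` with the
  columns where `φ = 0` (`κ₀`), and BOTH induced symbolic matrices — rows avoiding `a` × columns `φ = 0`, and rows containing `a`
  with `a` erased × columns `φ ≠ 0` — are good, then `symbAdd u e` is good. Proof: specialise the variables of coordinate `a`
  to the constants of `φ` (an algebra endomorphism); the matrix becomes block-triangular with determinant
  `± (∏ φ) · det(block₀) · det(block₁) ≠ 0`, and a polynomial with a nonzero specialisation is nonzero.
* `symbGood_of_subsingleton`, `symbGood_strip` — base case and the removal of a coordinate common to all rows.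

USE (cell record, census of this seat): with `a` a maximum-degree coordinate of the column family and `{k : φ(e k) = 0}` a
FLAT of the hidden family of the right size, the rule is a complete certificate calculus for Q\* at `h = 4` (all 65 535 families,
`K = 4`) and certifies every sampled family at `h = 5, 6`; it is strictly stronger than tropical (unique-optimum) certificates.

WHAT THIS IS NOT: no family is proved good here beyond the trivial base cases; Q\* and item 19717 stay open; nothing on CPM,
crux 14610 or VP ≠ VNP.
-/

set_option linter.dupNamespace false

namespace Summit.ValiantsHypothesis.ValiantsHypothesis.Theorems.BarrierLever.HiddenStates

open Finset Matrix MvPolynomial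

noncomputable section

variable {K h : ℕ}

/-! ## 1. The symbolic additive matrix -/

/-- The generic affine functional of coordinate `a` evaluated at the hidden set `J`:
`X (none, a) + Σ_{q ∈ J} X (some q, a)`. -/
def symbLin (K h : ℕ) (a : Fin h) (J : Finset (Fin K)) : MvPolynomial (Option (Fin K) × Fin h) ℂ :=
  X (none, a) + ∑ q ∈ J, X (some q, a)

/-- The SYMBOLIC additive matrix of a column family `u` against a hidden family `e` (same index type):
entry `(i, k)` is `∏_{a ∈ u i} symbLin a (e k)`. -/
def symbAdd {n : Type*} (u : n → Finset (Fin h)) (e : n → Finset (Fin K)) :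
    Matrix n n (MvPolynomial (Option (Fin K) × Fin h) ℂ) :=
  Matrix.of fun i k => ∏ a ∈ u i, symbLin K h a (e k)

/-- Symbolic goodness: the symbolic additive matrix has nonzero determinant (as a polynomial). -/
def SymbGood {n : Type*} [Fintype n] [DecidableEq n] (u : n → Finset (Fin h)) (e : n → Finset (Fin K)) : Prop :=
  (symbAdd u e).det ≠ 0

/-- Evaluating the symbolic matrix at a table gives the numeric additive matrix. -/
theorem eval_symbAdd {n : Type*} (u : n → Finset (Fin h)) (e : n → Finset (Fin K))
    (tx : Option (Fin K) × Fin h → ℂ) (i k : n) :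
    MvPolynomial.eval tx (symbAdd u e i k) = ∏ a ∈ u i, (tx (none, a) + ∑ q ∈ e k, tx (some q, a)) := by
  simp only [symbAdd, Matrix.of_apply, map_prod, symbLin, map_add, map_sum, MvPolynomial.eval_X]

/-- **A symbolically good pair has a numeric table** with nonsingular additive matrix (nonzero polynomials over `ℂ` have
non-roots). The table is curried as in `BallGood`. -/
theorem exists_table_of_symbGood {n : Type*} [Fintype n] [DecidableEq n] (u : n → Finset (Fin h))
    (e : n → Finset (Fin K)) (hg : SymbGood u e) :
    ∃ tx : Option (Fin K) → Fin h → ℂ,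
      (Matrix.of fun i k : n => ∏ a ∈ u i, (tx none a + ∑ q ∈ e k, tx (some q) a)).det ≠ 0 := by
  classical
  by_contra hcon
  push Not at hcon
  apply hg
  apply MvPolynomial.funext
  intro x
  rw [map_zero, RingHom.map_det]
  have hmat : (MvPolynomial.eval x).mapMatrix (symbAdd u e) =
      Matrix.of fun i k : n => ∏ a ∈ u i, (x (none, a) + ∑ q ∈ e k, x (some q, a)) :=
    Matrix.ext fun i k => by rw [RingHom.mapMatrix_apply, Matrix.map_apply, eval_symbAdd, Matrix.of_apply]
  rw [hmat]
  exact hcon fun o b => x (o, b)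

/-- Conversely a numeric table with nonsingular additive matrix shows symbolic goodness. -/
theorem symbGood_of_table {n : Type*} [Fintype n] [DecidableEq n] (u : n → Finset (Fin h))
    (e : n → Finset (Fin K)) (tx : Option (Fin K) → Fin h → ℂ)
    (hx : (Matrix.of fun i k : n => ∏ a ∈ u i, (tx none a + ∑ q ∈ e k, tx (some q) a)).det ≠ 0) :
    SymbGood u e := by
  classical
  intro hzero
  apply hx
  have := RingHom.map_det (MvPolynomial.eval fun p : Option (Fin K) × Fin h => tx p.1 p.2) (symbAdd u e)
  rw [hzero, map_zero] at this
  have hmat : (MvPolynomial.eval fun p : Option (Fin K) × Fin h => tx p.1 p.2).mapMatrix (symbAdd u e) =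
      Matrix.of fun i k : n => ∏ a ∈ u i, (tx none a + ∑ q ∈ e k, tx (some q) a) :=
    Matrix.ext fun i k => by rw [RingHom.mapMatrix_apply, Matrix.map_apply, eval_symbAdd, Matrix.of_apply]
  rw [hmat] at this
  exact this.symm

/-! ## 2. Base cases -/

/-- The symbolic affine functional is a nonzero polynomial (its constant variable `X (none, a)` has coefficient `1`). -/
theorem symbLin_ne_zero (a : Fin h) (J : Finset (Fin K)) : symbLin K h a J ≠ 0 := by
  intro hz
  have hc := congrArg (MvPolynomial.eval fun v : Option (Fin K) × Fin h => if v = (none, a) then (1 : ℂ) else 0) hz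
  simp only [symbLin, map_add, map_sum, MvPolynomial.eval_X, map_zero] at hc
  rw [Finset.sum_eq_zero fun q _ => if_neg (by simp), add_zero] at hc
  exact one_ne_zero hc

/-- Base case: with at most one row the symbolic matrix is good (its determinant is `1` or a product of nonzero
linear polynomials). -/
theorem symbGood_of_subsingleton {n : Type*} [Fintype n] [DecidableEq n] [Subsingleton n]
    (u : n → Finset (Fin h)) (e : n → Finset (Fin K)) : SymbGood u e := by
  unfold SymbGood
  rcases isEmpty_or_nonempty n with hn | hn
  · rw [Matrix.det_isEmpty]; exact one_ne_zero
  · obtain ⟨i₀⟩ := hn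
    haveI : Unique n := uniqueOfSubsingleton i₀
    rw [Matrix.det_unique, symbAdd, Matrix.of_apply]
    exact Finset.prod_ne_zero_iff.mpr fun a _ => symbLin_ne_zero a _

/-- **Strip a common coordinate.** If `a` lies in every row then goodness of the family with `a` erased implies goodness
(the determinant acquires the nonzero factor `∏_k symbLin a (e k)`). -/
theorem symbGood_strip {n : Type*} [Fintype n] [DecidableEq n] (u : n → Finset (Fin h)) (e : n → Finset (Fin K))
    (a : Fin h) (ha : ∀ i, a ∈ u i) (hg : SymbGood (fun i => (u i).erase a) e) : SymbGood u e := by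
  unfold SymbGood at hg ⊢
  have hmat : symbAdd u e = Matrix.of fun i k => symbLin K h a (e k) * symbAdd (fun i => (u i).erase a) e i k :=
    Matrix.ext fun i k => by
      simp only [symbAdd, Matrix.of_apply]
      rw [Finset.mul_prod_erase (u i) (fun b => symbLin K h b (e k)) (ha i)]
  rw [hmat, Matrix.det_mul_row]
  exact mul_ne_zero (Finset.prod_ne_zero_iff.mpr fun k _ => symbLin_ne_zero a _) hg

/-! ## 3. The split rule -/

section Split

variable {n : Type*} [Fintype n] [DecidableEq n]

/-- The specialisation of coordinate `a` to the affine functional with constants `c₀, c`: an algebra endomorphism of the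
polynomial ring sending `X (none, a) ↦ C c₀`, `X (some q, a) ↦ C (c q)` and fixing the variables of the other coordinates. -/
def splitSpec (K h : ℕ) (a : Fin h) (c₀ : ℂ) (c : Fin K → ℂ) :
    MvPolynomial (Option (Fin K) × Fin h) ℂ →ₐ[ℂ] MvPolynomial (Option (Fin K) × Fin h) ℂ :=
  MvPolynomial.aeval fun v => if v.2 = a then C (Option.elim v.1 c₀ c) else X v

/-- The specialisation sends the functional of coordinate `a` to the constant `φ(J) = c₀ + Σ_{q∈J} c q`. -/
theorem splitSpec_symbLin_self (a : Fin h) (c₀ : ℂ) (c : Fin K → ℂ) (J : Finset (Fin K)) :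
    splitSpec K h a c₀ c (symbLin K h a J) = C (c₀ + ∑ q ∈ J, c q) := by
  simp only [splitSpec, symbLin, map_add, map_sum, MvPolynomial.aeval_X, ite_true, Option.elim]

/-- The specialisation fixes the functionals of the other coordinates. -/
theorem splitSpec_symbLin_ne (a b : Fin h) (hb : b ≠ a) (c₀ : ℂ) (c : Fin K → ℂ) (J : Finset (Fin K)) :
    splitSpec K h a c₀ c (symbLin K h b J) = symbLin K h b J := by
  simp only [splitSpec, symbLin, map_add, map_sum, MvPolynomial.aeval_X, if_neg hb]

omit [Fintype n] [DecidableEq n] in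
/-- The specialised matrix: rows containing `a` pick up the constant factor `φ(e k)`, with `a` erased from the product. -/
theorem splitSpec_symbAdd (u : n → Finset (Fin h)) (e : n → Finset (Fin K)) (a : Fin h) (c₀ : ℂ) (c : Fin K → ℂ)
    (i k : n) :
    splitSpec K h a c₀ c (symbAdd u e i k) =
      (if a ∈ u i then C (c₀ + ∑ q ∈ e k, c q) else 1) * symbAdd (fun i => (u i).erase a) e i k := by
  simp only [symbAdd, Matrix.of_apply, map_prod]
  by_cases hai : a ∈ u i
  · rw [if_pos hai, ← Finset.mul_prod_erase _ _ hai, splitSpec_symbLin_self]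
    congr 1
    exact Finset.prod_congr rfl fun b hb => splitSpec_symbLin_ne a b (Finset.ne_of_mem_erase hb) c₀ c _
  · rw [if_neg hai, one_mul, Finset.erase_eq_of_notMem hai]
    exact Finset.prod_congr rfl fun b hb => splitSpec_symbLin_ne a b (fun h' => hai (h' ▸ hb)) c₀ c _

/-- **THE SPLIT RULE (exact hyperplane sections).** Let `a : Fin h` and `φ(J) = c₀ + Σ_{q∈J} c q`. Suppose
`κ₁ : {i // a ∈ u i} ≃ {k // φ(e k) ≠ 0}` and `κ₀ : {i // a ∉ u i} ≃ {k // φ(e k) = 0}` (so the rows containing `a` are as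
many as the hidden sets off the hyperplane `φ = 0`), and both induced pairs are symbolically good:
rows avoiding `a` against the hidden sets ON the hyperplane, and rows containing `a` (with `a` erased) against the hidden sets
OFF it. Then `SymbGood u e`. -/
theorem symbGood_of_split (u : n → Finset (Fin h)) (e : n → Finset (Fin K)) (a : Fin h) (c₀ : ℂ) (c : Fin K → ℂ)
    (κ₁ : {i // a ∈ u i} ≃ {k // c₀ + ∑ q ∈ e k, c q ≠ 0})
    (κ₀ : {i // a ∉ u i} ≃ {k // c₀ + ∑ q ∈ e k, c q = 0})
    (h₁ : SymbGood (fun i : {i // a ∈ u i} => (u i.1).erase a) (fun i => e (κ₁ i).1))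
    (h₀ : SymbGood (fun i : {i // a ∉ u i} => u i.1) (fun i => e (κ₀ i).1)) :
    SymbGood u e := by
  classical
  set φ : n → ℂ := fun k => c₀ + ∑ q ∈ e k, c q with hφ
  -- it suffices that the specialisation of the determinant is nonzero
  intro hzero
  have hspec : ((splitSpec K h a c₀ c).toRingHom.mapMatrix (symbAdd u e)).det = 0 := by
    rw [← RingHom.map_det, AlgHom.toRingHom_eq_coe, RingHom.coe_coe, hzero, map_zero]
  -- the specialised matrix
  set N : Matrix n n (MvPolynomial (Option (Fin K) × Fin h) ℂ) :=
    (splitSpec K h a c₀ c).toRingHom.mapMatrix (symbAdd u e) with hN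
  have hNapply : ∀ i k, N i k = (if a ∈ u i then C (φ k) else 1) * symbAdd (fun i => (u i).erase a) e i k := by
    intro i k
    rw [hN, RingHom.mapMatrix_apply, Matrix.map_apply, AlgHom.toRingHom_eq_coe, RingHom.coe_coe, splitSpec_symbAdd]
  -- reindex rows by `a ∈ u i` and columns through `κ₁, κ₀`
  let ρ : {i // a ∈ u i} ⊕ {i // a ∉ u i} ≃ n := Equiv.sumCompl fun i => a ∈ u i
  let κ₀' : {i // a ∉ u i} ≃ {k // ¬ (φ k ≠ 0)} := κ₀.trans (Equiv.subtypeEquivRight fun k => by rw [not_not])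
  let σ : {i // a ∈ u i} ⊕ {i // a ∉ u i} ≃ n := (Equiv.sumCongr κ₁ κ₀').trans (Equiv.sumCompl fun k => φ k ≠ 0)
  have hσ_inl : ∀ j : {i // a ∈ u i}, σ (Sum.inl j) = (κ₁ j).1 := fun j => rfl
  have hσ_inr : ∀ j : {i // a ∉ u i}, σ (Sum.inr j) = (κ₀ j).1 := fun j => rfl
  have hρ_inl : ∀ i : {i // a ∈ u i}, ρ (Sum.inl i) = i.1 := fun i => rfl
  have hρ_inr : ∀ i : {i // a ∉ u i}, ρ (Sum.inr i) = i.1 := fun i => rfl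
  -- the reindexed matrix is block lower-triangular
  set B₁₁ : Matrix {i // a ∈ u i} {i // a ∈ u i} _ :=
    Matrix.of fun i j => C (φ (κ₁ j).1) * symbAdd (fun i : {i // a ∈ u i} => (u i.1).erase a) (fun i => e (κ₁ i).1) i j
    with hB₁₁
  set B₀₁ : Matrix {i // a ∉ u i} {i // a ∈ u i} _ :=
    Matrix.of fun i j => symbAdd (fun i => (u i).erase a) e i.1 (κ₁ j).1 with hB₀₁
  set B₀₀ : Matrix {i // a ∉ u i} {i // a ∉ u i} _ :=
    symbAdd (fun i : {i // a ∉ u i} => u i.1) (fun i => e (κ₀ i).1) with hB₀₀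
  have hblocks : N.submatrix ρ σ = Matrix.fromBlocks B₁₁ 0 B₀₁ B₀₀ := by
    refine Matrix.ext fun x y => ?_
    rcases x with i | i <;> rcases y with j | j
    · rw [Matrix.submatrix_apply, Matrix.fromBlocks_apply₁₁, hρ_inl, hσ_inl, hNapply, if_pos i.2, hB₁₁, Matrix.of_apply]
      rfl
    · rw [Matrix.submatrix_apply, Matrix.fromBlocks_apply₁₂, hρ_inl, hσ_inr, hNapply, if_pos i.2, Matrix.zero_apply]
      have : φ (κ₀ j).1 = 0 := (κ₀ j).2
      rw [this, map_zero, zero_mul]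
    · rw [Matrix.submatrix_apply, Matrix.fromBlocks_apply₂₁, hρ_inr, hσ_inl, hNapply, if_neg i.2, one_mul, hB₀₁,
        Matrix.of_apply]
    · rw [Matrix.submatrix_apply, Matrix.fromBlocks_apply₂₂, hρ_inr, hσ_inr, hNapply, if_neg i.2, one_mul, hB₀₀]
      simp only [symbAdd, Matrix.of_apply]
      rw [Finset.erase_eq_of_notMem i.2]
  -- determinant bookkeeping
  have hdetsub : (N.submatrix ρ σ).det = Equiv.Perm.sign (ρ.trans σ.symm) * N.det := by
    have : N.submatrix ρ σ = (N.submatrix ⇑σ ⇑σ).submatrix ⇑(ρ.trans σ.symm) id :=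
      Matrix.ext fun x y => by simp only [Matrix.submatrix_apply, Equiv.trans_apply, Equiv.apply_symm_apply, id]
    rw [this, Matrix.det_permute, Matrix.det_submatrix_equiv_self]
  have hB₁₁det : B₁₁.det = (∏ j, C (φ (κ₁ j).1)) *
      (symbAdd (fun i : {i // a ∈ u i} => (u i.1).erase a) (fun i => e (κ₁ i).1)).det := by
    rw [hB₁₁]
    exact Matrix.det_mul_row (fun j => C (φ (κ₁ j).1)) _
  have hprod : (∏ j : {i // a ∈ u i}, C (φ (κ₁ j).1) : MvPolynomial (Option (Fin K) × Fin h) ℂ) ≠ 0 :=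
    Finset.prod_ne_zero_iff.mpr fun j _ => by
      rw [Ne, MvPolynomial.C_eq_zero]; exact (κ₁ j).2
  have hNdet : N.det ≠ 0 := by
    intro hN0
    have h1 : (N.submatrix ρ σ).det = 0 := by rw [hdetsub, hN0, mul_zero]
    rw [hblocks, Matrix.det_fromBlocks_zero₁₂, hB₁₁det] at h1
    exact (mul_ne_zero (mul_ne_zero hprod h₁) h₀) h1
  exact hNdet hspec

end Split

end

end Summit.ValiantsHypothesis.ValiantsHypothesis.Theorems.BarrierLever.HiddenStates
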